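import Mathlib
import Summits.Ventures.DiscreteObjects.Mahler.CyclotomicIntegerSchinzel
import Summits.Ventures.DiscreteObjects.Mahler.CyclotomicIntegerLehmerAll
import Summits.Ventures.DiscreteObjects.Mahler.DobrowolskiSeparation

/-!
# Schinzel's theorem for cyclotomic integers, Mahler-measure form: `φ^{deg α} ≤ M(α)²` (venture `DiscreteObjects`, target L)

Cell `pub-namedobj`, seat `pub-namedobj-mahler-g28`. Framing: lottery ticket; floor = certified bounds/negative ranges.

Translation of `CyclotomicIntegerSchinzel.goldenRatio_pow_totient_le_prod_sq` (Schinzel 1973, CM case; Höhn–Skoruppa's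
proof) by `CyclotomicIntegerLehmerAll.exists_prod_max_eq_measure_pow`: **for every `m ≥ 1`, every primitive `m`-th root
of unity `ζ ∈ ℂ` and every `g ∈ ℤ[X]` with `α = g(ζ)` neither `0` nor a root of unity, `φ^{deg α} ≤ M(α)²`**,
`φ = (1+√5)/2` (`goldenRatio_pow_le_measure_sq`; `h(α) ≥ ½ log φ = 0.2406…`), hence `M(α) ≥ φ` in degree `≥ 2`
(`goldenRatio_le_measure`, SHARP: `M(x² - x - 1) = φ`, `φ = 1 + ζ₅ + ζ₅⁴`, see `GoldenRatioSharpness`) and a conjugate of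
modulus `≥ √φ = 1.2720…` (`exists_conjugate_norm_sq_ge_goldenRatio`).  For cyclotomic INTEGERS this supersedes in strength
the general abelian bound [cite: BombieriGubler2001, Theorem 4.4.9] (`log(5/2)/10`, `CyclotomicIntegerLehmerAll`) and the
2-adic bound (`(log 2)/6`, `CyclotomicIntegerLehmerTwo`), whose methods however apply to all `α ∈ ℚ(ζ_m)`.
REPLICATION of a classical theorem; no new mathematics claimed.
-/

namespace Summit.Ventures.DiscreteObjects.Mahler

open Polynomial Finset

/-- **Schinzel's theorem for cyclotomic integers: `φ^{deg α} ≤ M(α)²`.**  For every `m ≥ 1`, every primitive `m`-th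
root of unity `ζ ∈ ℂ` and every `g ∈ ℤ[X]` with `α = g(ζ)` neither `0` nor a root of unity, `φ^{deg α} ≤ M(α)²`,
`φ = (1+√5)/2` — i.e. `h(α) ≥ ½ log φ = 0.2406…`; equality for `α = φ = 1 + ζ₅ + ζ₅⁴` (`M(x² - x - 1) = φ`,
`GoldenRatioSharpness`). -/
theorem goldenRatio_pow_le_measure_sq {m : ℕ} (hm : 0 < m) (g : ℤ[X]) {ζ : ℂ} (hζ : IsPrimitiveRoot ζ m)
    (h0 : aeval ζ g ≠ 0) (hnu : ∀ k : ℕ, 0 < k → aeval ζ g ^ k ≠ 1) :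
    Real.goldenRatio ^ (minpoly ℤ (aeval ζ g)).natDegree ≤ intMahlerMeasure (minpoly ℤ (aeval ζ g)) ^ 2 := by
  obtain ⟨e, he0, hed, hprod⟩ := exists_prod_max_eq_measure_pow hm g hζ
  have hB := goldenRatio_pow_totient_le_prod_sq hm g hζ h0 hnu
  set M := intMahlerMeasure (minpoly ℤ (aeval ζ g)) with hM
  set d := (minpoly ℤ (aeval ζ g)).natDegree with hd
  have hR : (M ^ e) ^ 2 = (M ^ 2) ^ e := by rw [← pow_mul, ← pow_mul, mul_comm]
  rw [hprod, ← hed, hR, mul_comm e d, pow_mul] at hB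
  have hζint : IsIntegral ℤ ζ := hζ.isIntegral hm
  have hαint : IsIntegral ℤ (aeval ζ g) := by
    have hmem : aeval ζ g ∈ Algebra.adjoin ℤ {ζ} := Polynomial.aeval_mem_adjoin_singleton ℤ ζ
    exact (mem_integralClosure_iff ℤ ℂ).1 (adjoin_le_integralClosure hζint hmem)
  have hM0 : 0 ≤ M := le_trans zero_le_one (one_le_intMahlerMeasure (minpoly.monic hαint).ne_zero)
  exact (pow_le_pow_iff_left₀ (by positivity) (by positivity) he0).1 hB

/-- **`M(α) ≥ φ = 1.618…` for every nonzero non-torsion cyclotomic integer of degree `≥ 2`** (sharp: `α = φ`); in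
degree `1`, `M(α) = |α| ≥ 2`.  In particular `M(α) > M(ℓ) = 1.17628…` (Lehmer) with a wide margin. -/
theorem goldenRatio_le_measure {m : ℕ} (hm : 0 < m) (g : ℤ[X]) {ζ : ℂ} (hζ : IsPrimitiveRoot ζ m)
    (h0 : aeval ζ g ≠ 0) (hnu : ∀ k : ℕ, 0 < k → aeval ζ g ^ k ≠ 1) (hd : 2 ≤ (minpoly ℤ (aeval ζ g)).natDegree) :
    Real.goldenRatio ≤ intMahlerMeasure (minpoly ℤ (aeval ζ g)) := by
  have hB := goldenRatio_pow_le_measure_sq hm g hζ h0 hnu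
  have hφ1 : (1 : ℝ) ≤ Real.goldenRatio := Real.one_lt_goldenRatio.le
  have h1 : Real.goldenRatio ^ 2 ≤ intMahlerMeasure (minpoly ℤ (aeval ζ g)) ^ 2 :=
    (pow_le_pow_right₀ hφ1 hd).trans hB
  have hζint : IsIntegral ℤ ζ := hζ.isIntegral hm
  have hαint : IsIntegral ℤ (aeval ζ g) := by
    have hmem : aeval ζ g ∈ Algebra.adjoin ℤ {ζ} := Polynomial.aeval_mem_adjoin_singleton ℤ ζ
    exact (mem_integralClosure_iff ℤ ℂ).1 (adjoin_le_integralClosure hζint hmem)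
  have hM0 : 0 ≤ intMahlerMeasure (minpoly ℤ (aeval ζ g)) :=
    le_trans zero_le_one (one_le_intMahlerMeasure (minpoly.monic hαint).ne_zero)
  exact (pow_le_pow_iff_left₀ Real.goldenRatio_pos.le hM0 two_ne_zero).1 h1

/-- **A uniform house bound**: every nonzero non-torsion cyclotomic integer has a conjugate `β` with `|β|² ≥ φ`,
i.e. house `≥ √φ = 1.2720…`, uniformly in the degree (sharp: `α = φ`). -/
theorem exists_conjugate_norm_sq_ge_goldenRatio {m : ℕ} (hm : 0 < m) (g : ℤ[X]) {ζ : ℂ} (hζ : IsPrimitiveRoot ζ m)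
    (h0 : aeval ζ g ≠ 0) (hnu : ∀ k : ℕ, 0 < k → aeval ζ g ^ k ≠ 1) :
    ∃ β ∈ ((minpoly ℤ (aeval ζ g)).map (Int.castRingHom ℂ)).roots, Real.goldenRatio ≤ ‖β‖ ^ 2 := by
  classical
  have hζint : IsIntegral ℤ ζ := hζ.isIntegral hm
  have hαint : IsIntegral ℤ (aeval ζ g) := by
    have hmem : aeval ζ g ∈ Algebra.adjoin ℤ {ζ} := Polynomial.aeval_mem_adjoin_singleton ℤ ζ
    exact (mem_integralClosure_iff ℤ ℂ).1 (adjoin_le_integralClosure hζint hmem)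
  set f : ℤ[X] := minpoly ℤ (aeval ζ g) with hf
  have hmon : f.Monic := minpoly.monic hαint
  have hB := goldenRatio_pow_le_measure_sq hm g hζ h0 hnu
  set d := f.natDegree with hd
  have hdpos : 0 < d := minpoly.natDegree_pos hαint
  have hφ1 : (1 : ℝ) < Real.goldenRatio := Real.one_lt_goldenRatio
  have hM1 : 1 ≤ intMahlerMeasure f := one_le_intMahlerMeasure hmon.ne_zero
  have hM : 1 < intMahlerMeasure f := by
    by_contra hle
    have hle' : intMahlerMeasure f ≤ 1 := le_of_not_gt hle
    have h1 : intMahlerMeasure f ^ 2 ≤ 1 := pow_le_one₀ (by linarith) hle'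
    have h2 : Real.goldenRatio ≤ Real.goldenRatio ^ d := by
      calc Real.goldenRatio = Real.goldenRatio ^ 1 := (pow_one _).symm
        _ ≤ Real.goldenRatio ^ d := pow_le_pow_right₀ hφ1.le hdpos
    have h3 : Real.goldenRatio ^ d ≤ intMahlerMeasure f ^ 2 := hB
    linarith
  obtain ⟨z, hz, hz1, hmax⟩ := exists_root_norm_gt_one hmon hM
  refine ⟨z, hz, ?_⟩
  set RC := (f.map (Int.castRingHom ℂ)).roots with hRC
  have hcard : RC.card = d := by
    rw [hRC, splits_iff_card_roots.1 (IsAlgClosed.splits _),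
      natDegree_map_eq_of_injective (Int.castRingHom ℂ).injective_int]
  have hMle : intMahlerMeasure f ≤ ‖z‖ ^ d := by
    have hMf : intMahlerMeasure f = (RC.map fun γ => max 1 ‖γ‖).prod := by
      unfold intMahlerMeasure
      rw [mahlerMeasure_eq_leadingCoeff_mul_prod_roots, (hmon.map (Int.castRingHom ℂ)).leadingCoeff, norm_one,
        one_mul]
    rw [hMf]
    calc (RC.map fun γ => max 1 ‖γ‖).prod ≤ (RC.map fun _ => ‖z‖).prod :=
          Multiset.prod_map_le_prod_map₀ _ _ (fun γ _ => by positivity) (fun γ hγ => max_le hz1.le (hmax γ hγ))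
      _ = ‖z‖ ^ d := by rw [Multiset.map_const', Multiset.prod_replicate, hcard]
  have hM0 : 0 ≤ intMahlerMeasure f := by linarith
  have h1 : Real.goldenRatio ^ d ≤ (‖z‖ ^ 2) ^ d := by
    calc Real.goldenRatio ^ d ≤ intMahlerMeasure f ^ 2 := hB
      _ ≤ (‖z‖ ^ d) ^ 2 := pow_le_pow_left₀ hM0 hMle 2
      _ = (‖z‖ ^ 2) ^ d := by rw [← pow_mul, ← pow_mul, mul_comm]
  exact (pow_le_pow_iff_left₀ Real.goldenRatio_pos.le (by positivity) hdpos.ne').1 h1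

end Summit.Ventures.DiscreteObjects.Mahler
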